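import Summits.QuantumFields.YangMills.Theorems.BalabanUVNodesN06DgLegAtPinsPhysPU
import Literature.MathematicalPhysics.QuantumFieldTheory.Balaban1983to89.B9GradViaDivLettersPrintWeight

/-!
# BalabanUVNodes ∕ N06 ([B9], `Dag.B9_main`) — ROWS 20–21's PRODUCER `rgdH` (R∇*_UG₁ : 𝔠⁽⁰⁾ → `bH13 x U`) DERIVED AT THE PRINT-WEIGHTED PIN (P2′) from the certificate's own sup
# letter `rgd2` (R∇*_UG₁ : 𝔠⁽⁰⁾ → 𝔠_W⁽¹⁾, (3.42)₂+(3.49) species) and a (3.44)-type GRADIENT WORD `D_U∘R∇*_UG₁ : 𝔠⁽⁰⁾ → 𝔠_X⁽⁰⁾` — dag-n06-l's (3.43)-as-a-class-statement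
# `B9GradViaDivLettersPrintWeight.hasMaj_into_bHZPG_of_grad` read at the members; NO member facts (no threshold)

Track A of `YM-PLAN.md` (cell `pub-ymgap`, HUMAN RULING D-0062), node **N06** = [Balaban1985BackgroundPropagators] Thms 3.1–3.15; seat `pub-ymgap-dag-n06-d`
(gen 16).  WHY (dag-n06-l PIN RECIPE v2, cell INBOX 2026-08-29T00:49Z: «PRODUCERS now derivable: `rgdH ∕ tbH ∕ tb₂H` via `hasMaj_into_bHZPG_of_grad` from (sup word at
`cNormR (blkSK (sIK bI)) (−1)`, gradient word `DvcoKH U ∘ T` at `cNormR (blkBK bI) 0`) — for `rgdH` the sup word IS your derived `rgd2`»).  The certificate displays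
`hrgdH : 𝔠⁽⁰⁾ → bH13 x U` for `R∇*_UG₁` (constant `B12₃`); at (P2′) this is (3.43)+(3.42)₂+(3.49) for G′ ∘ the restriction — print-inhabitable but still a COMPOSITE display.
dag-n06-l's producer lands ANY operator `T` in `bHZPG (taxiS U) w` from two printed-species members: a sup word `T : b₁ → 𝔠^{(−1)}` (`|Tμ| ≤ Lʲη·C₀e^{−δd}`) and a gradient word
`D_U∘T : b₁ → 𝔠⁽⁰⁾` (`|D_UTμ| ≤ C₁e^{−δd}`, (3.44)-type), with the closed constant `L·(C₀e^{δ(r_near+1)} + (d+1)·(coordBound39·basisBound39)·C₁·e^{δ(r_near+2(d+1)L²+2)})`.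
THIS FILE reads it at the members: the sup word is the certificate's displayed `rgd2` letter (edition 65's `hZ8`, 4th conjunct: `cNorm … blkW _ 1` = `cNormR … (blkSK (sIK bI)) _ (−1)`
by `hblkW12` and `cNorm_one_eq_cNormR`), the gradient word a NEW displayed member `hrgdG : HasMaj (cNorm … blk _ 0) (cNormR … blk _ 0) (D_U ∘ (R∇*_UG₁)) (C₁·e^{−δ d})` (read on
`blkBK bI` by `hblk12`, `D_U = DvcoKH` by `hDvco12`), `U ∈ SU(N)` from the class axiom `hGR` (`links_le_one`), print's units by `MemberY.hcfk`:
* `cNorm_one_eq_cNormR`, `cNorm_zero_eq_cNormR` — the integer-weight state norms as real-weight ones (bookkeeping);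
* ★★ `hrgdH_of_pinsP_geo9Y` — member-∀ (NO threshold: no member fact enters): `HasMaj (cNorm 1 (H x) (𝔬12 x).blk _ 0) (bH13 x U) (R∇*_UG₁) (B₃·e^{−δ d})` for every displayed
  `B₃` above the closed constant (`hB₃`).
HONEST FRAMING.  Kernel bookkeeping over a landed Literature theorem; `rgd2` and the gradient word are HYPOTHESES (the instance's letters ∕ a (3.44)-type member); nothing of
[B9] asserted; COUNT-NEUTRAL; N06 NOT discharged; K1⁹ NOT closed; one finite 𝕋⁴ programme at fixed `ε` — NOT continuum ∕ OS ∕ mass gap ∕ Clay.  0 `def`, 0 `sorry`.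
-/

noncomputable section

namespace Summit.QuantumFields.YangMills.BalabanUVNodes.N06RgdHLegAtPinsPhysPU

open Literature.MathematicalPhysics.QuantumFieldTheory.Balaban1983to89
open Literature.MathematicalPhysics.QuantumFieldTheory.Balaban1983to89.Node00 (FBondY IBondY SiteY levY toKT CfgY)
open Literature.MathematicalPhysics.QuantumFieldTheory.Balaban1983to89.B9Thm34Ext (toB6)
open Literature.MathematicalPhysics.QuantumFieldTheory.Balaban1983to89.B11SectG (HasMaj BlockNorm RowSum)
open Literature.MathematicalPhysics.QuantumFieldTheory.Balaban1983to89.B9Thm312Whole (cNorm GeoOK)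
open Literature.MathematicalPhysics.QuantumFieldTheory.Balaban1983to89.B9Thm312WholeClasses (cNormR)
open Literature.MathematicalPhysics.QuantumFieldTheory.Balaban1983to89.B9RWSums343Holder (HolderProbes)
open Literature.MathematicalPhysics.QuantumFieldTheory.Balaban1983to89.B9RWSums343to347Whole (Facts347)
open Literature.MathematicalPhysics.QuantumFieldTheory.Balaban1983to89.B9RWSums346SecondDiff (DirOps310)
open Literature.MathematicalPhysics.QuantumFieldTheory.Balaban1983to89.B9Thm310Whole (Ops310)
open Literature.MathematicalPhysics.QuantumFieldTheory.Balaban1983to89.B9CoReadingCoords (coordOpK XBK blkBK cdBₗ cdsBₗ DcoK)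
open Literature.MathematicalPhysics.QuantumFieldTheory.Balaban1983to89.B9CoReadingCoordsS (XSK sIK)
open Literature.MathematicalPhysics.QuantumFieldTheory.Balaban1983to89.B9CoReadingCoordsH (XHK)
open Literature.MathematicalPhysics.QuantumFieldTheory.Balaban1983to89.B9CoReadingCoordsHolder (PK)
open Literature.MathematicalPhysics.QuantumFieldTheory.Balaban1983to89.B9CoReadingCoordsTranspose (TrIdx trBasis)
open Literature.MathematicalPhysics.QuantumFieldTheory.Balaban1983to89.B9PinMembersKLevelV1 (MemberY geo9Y bg9Y)
open Literature.MathematicalPhysics.QuantumFieldTheory.Balaban1983to89.B9BackgroundsKLevelV1R (RegFamY bg9YR MemOfFam mem_of_reg335R)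
open Literature.MathematicalPhysics.QuantumFieldTheory.Balaban1983to89.B9GeoLemma21KLevelV1 (geo9Y_len_pos geo9Y_dist_triangle geo9Y_dist_comm rowSum261_geo9Y)
open Literature.MathematicalPhysics.QuantumFieldTheory.Balaban1983to89.B9GeoNormsKLevelV1 (geo9K geo9K_dist_nonneg)
open Literature.MathematicalPhysics.QuantumFieldTheory.Balaban1983to89.B7Prop2SpecialUnitary (specialUnitaryUnits)
open Literature.MathematicalPhysics.QuantumFieldTheory.Balaban1983to89.B9RWSums347DefiniteFaces (exp261 facts347_exp261_geo9Y geo9Y_scalars)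
open Literature.MathematicalPhysics.QuantumFieldTheory.Balaban1983to89.B9RowSum261DefiniteFaces (rowConst261 rowConst261_nonneg rowConst261_spec_of_rowSum261)
open B6GlobalChartV1 (PV blkV1) open B6Ineq2142KLevelV1 (β lvl) open B6Geom246MultiLevelTorus (geomT) open B6Prop22KLevelTorusCensusEta (nKT)
open Node00.OpsYSectDCoords (DvcoKH) open Node00.OpsYNablaBridge (chartY)
open B9MultiscaleSmoothPartitionYLip (CLip) open B9GradViaDivLettersTransported (taxiS taxiB)
open Literature.MathematicalPhysics.QuantumFieldTheory.Balaban1983to89.B9Thm313WholeDvHolderAtPinsGraded (thetaL CJG thetaL_nonneg CJG_nonneg)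
open Literature.MathematicalPhysics.QuantumFieldTheory.Balaban1983to89.B9TaxiTransportLadder (plaqV)
open Literature.MathematicalPhysics.QuantumFieldTheory.Balaban1983to89.B9GradViaDivLettersPrintWeight (hasMaj_into_bHZPG_of_grad)
open Literature.MathematicalPhysics.QuantumFieldTheory.Balaban1983to89.B9Thm312Whole (wt)
open Literature.MathematicalPhysics.QuantumFieldTheory.Balaban1983to89.B9Thm312WholeClasses (rwt)
open Literature.MathematicalPhysics.QuantumFieldTheory.Balaban1983to89.B9Thm39ReadingCoords (coordBound39 basisBound39)
open Literature.MathematicalPhysics.QuantumFieldTheory.Balaban1983to89.B9MultiscaleSmoothPartitionYNear (rNear)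
open Literature.MathematicalPhysics.QuantumFieldTheory.Balaban1983to89.B9CoReadingCoordsS (blkSK)
open Summit.QuantumFields.YangMills.BalabanUVNodes.N06HolderPinsGradedAtRecord (links_le_one)
open B9SmoothHolderClassP (bHZKP bHZPG bHZPG_κ) open B9SmoothHolderClassTClosure (abs_cf_eq_nKT)
open Summit.QuantumFields.YangMills.BalabanUVNodes.N06XdLegAtPinsPhysRU (one_le_CLip)
open scoped Matrix.Norms.L2Operator

variable {N : ℕ} {d ℓ : ℕ} {hd : 1 ≤ d + 1} {hL : Odd (ℓ + 1) ∧ 1 < ℓ + 1} {b₀ b₁ : ℝ} {Mstar : ℕ}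

/-- 𝔠⁽¹⁾ = 𝔠^{(−1)} (the weight `(Lʲη)⁻¹` written as a real power). [cite: Balaban1985BackgroundPropagators, (3.41) p.397, bookkeeping] -/
theorem cNorm_one_eq_cNormR {g : B9.Geometry} {X : Type} [Fintype X] [Fintype g.Site] (R₀ : ℝ) (H₀ : Prop) (blk : X → g.Site) (hlen : ∀ y : g.Site, 0 ≤ g.len y) :
    cNorm R₀ H₀ blk hlen 1 = cNormR R₀ H₀ blk hlen (-1) := by
  unfold cNorm cNormR; congr 1; funext y; simp [wt, rwt, Real.rpow_neg_one]

/-- 𝔠⁽⁰⁾ = 𝔠^{(0)}. [cite: Balaban1985BackgroundPropagators, (3.41) p.397, bookkeeping] -/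
theorem cNorm_zero_eq_cNormR {g : B9.Geometry} {X : Type} [Fintype X] [Fintype g.Site] (R₀ : ℝ) (H₀ : Prop) (blk : X → g.Site) (hlen : ∀ y : g.Site, 0 ≤ g.len y) :
    cNorm R₀ H₀ blk hlen 0 = cNormR R₀ H₀ blk hlen 0 := by
  unfold cNorm cNormR; congr 1; funext y; simp [wt, rwt]

/-- ★★ **`rgdH` DERIVED AT THE PRINT-WEIGHTED PIN (P2′)** (module docstring): member-∀, no threshold — from the displayed sup letter `rgd2` (constant `Brg`, rate `δ₃`), the displayed
(3.44)-type gradient word `hrgdG` (constant `C₁`, rate `δ₃`) and the pin (P2′), `HasMaj (cNorm … blk _ 0) (bH13 x U) (R∇*_UG₁) (B₃·e^{−δ₃ d})` for every `B₃` above the closed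
constant `(ℓ+1)·(Brg·e^{δ₃(r_near+1)} + (d+1)·(coordBound39 (trBasis N)·basisBound39 (trBasis N))·C₁·e^{δ₃(r_near+2(d+1)(ℓ+1)²+2)})` — dag-n06-l's `hasMaj_into_bHZPG_of_grad`.
[cite: Balaban1985BackgroundPropagators, Thm 3.1 (3.43) p.398 + (3.42) p.397 + (3.44) p.398 + (3.49) p.399 + Thm 3.13 (3.152) p.426; Balaban1984PropagatorsII, (2.51)–(2.54) pp.232–233] -/
theorem hrgdH_of_pinsP_geo9Y [NeZero N] [∀ x : MemberY d ℓ hd hL b₀ b₁ Mstar, Fintype (geo9Y x).Site]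
    {R₁ R₂ : RegFamY d ℓ hd hL b₀ b₁ Mstar (Matrix (Fin N) (Fin N) ℂ)} (H : MemberY d ℓ hd hL b₀ b₁ Mstar → Prop)
    (bI : ∀ x : MemberY d ℓ hd hL b₀ b₁ Mstar, FBondY x.toKIdx → IBondY x.toKIdx)
    (hlev : ∀ (x : MemberY d ℓ hd hL b₀ b₁ Mstar) (f : FBondY x.toKIdx), lvl x.hN x.D x.hk (bI x f) = (blkV1 x.hN x.D f).1.1)
    (hβ1 : ∀ (x : MemberY d ℓ hd hL b₀ b₁ Mstar) (f : FBondY x.toKIdx), (geomT x.D).dist (β x.hN x.D x.hk (bI x f)) (blkV1 x.hN x.D f) ≤ 1)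
    (hGR : MemOfFam (specialUnitaryUnits (Fin N)) R₁) (c : ℝ) {M₀ a₀ : ℝ}
    (w13 : ℝ → ℝ) (hw13₀ : ∀ s, 0 ≤ w13 s) (hw13₁ : ∀ s, w13 s ≤ 1)
    (bH13 : ∀ x : MemberY d ℓ hd hL b₀ b₁ Mstar, (bg9YR (Matrix (Fin N) (Fin N) ℂ) (specialUnitaryUnits (Fin N)) R₁ R₂ x).Cfg → BlockNorm (toB6 (geo9Y x) 1 (H x)) (XSK (TrIdx N) x.toKIdx → ℝ))
    (hbH13 : ∀ (x : MemberY d ℓ hd hL b₀ b₁ Mstar) (U : (bg9YR (Matrix (Fin N) (Fin N) ℂ) (specialUnitaryUnits (Fin N)) R₁ R₂ x).Cfg), bH13 x U =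
      letI : Fintype (geo9K x.toKIdx).Site := (inferInstance : Fintype (geo9Y x).Site);
      bHZPG (κ := TrIdx N) x.toKIdx (trBasis N) (taxiS x.toKIdx (bg9YR (Matrix (Fin N) (Fin N) ℂ) (specialUnitaryUnits (Fin N)) R₁ R₂ x) (fun U => U) U) (R := (1 : ℝ)) (H := H x) w13 hw13₀ hw13₁)
    (𝔬12 : ∀ x : MemberY d ℓ hd hL b₀ b₁ Mstar, B9Thm312Whole.Ops (geo9Y x) (bg9YR (Matrix (Fin N) (Fin N) ℂ) (specialUnitaryUnits (Fin N)) R₁ R₂ x) (XBK (TrIdx N) x.toKIdx) (XBK (TrIdx N) x.toKIdx) (XHK (TrIdx N) x.toKIdx) (XSK (TrIdx N) x.toKIdx))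
    (hblk12 : ∀ x : MemberY d ℓ hd hL b₀ b₁ Mstar, (𝔬12 x).blk = blkBK x.toKIdx (bI x))
    (hblkW12 : ∀ x : MemberY d ℓ hd hL b₀ b₁ Mstar, (𝔬12 x).blkW = blkSK x.toKIdx (sIK x.toKIdx (bI x)))
    (hDvco12 : ∀ (x : MemberY d ℓ hd hL b₀ b₁ Mstar) (U : (bg9YR (Matrix (Fin N) (Fin N) ℂ) (specialUnitaryUnits (Fin N)) R₁ R₂ x).Cfg), (𝔬12 x).Dv U = DvcoKH x.toKIdx (trBasis N) (bg9YR (Matrix (Fin N) (Fin N) ℂ) (specialUnitaryUnits (Fin N)) R₁ R₂ x) (fun U => U) U)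
    {Brg C₁ δ₃ B₃ : ℝ} (hBrg : 0 ≤ Brg) (hC₁ : 0 ≤ C₁) (hδ₃ : 0 ≤ δ₃)
    (hrgd2 : ∀ x : MemberY d ℓ hd hL b₀ b₁ Mstar, letI : Fintype (geo9K x.toKIdx).Site := (inferInstance : Fintype (geo9Y x).Site); M₀ ≤ (geo9Y x).M → ∀ α₀ : ℝ, 0 < α₀ → (geo9Y x).M * α₀ ≤ a₀ → ∀ U : (bg9YR (Matrix (Fin N) (Fin N) ℂ) (specialUnitaryUnits (Fin N)) R₁ R₂ x).Cfg, (bg9YR (Matrix (Fin N) (Fin N) ℂ) (specialUnitaryUnits (Fin N)) R₁ R₂ x).Reg335 c α₀ U →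
      (bg9YR (Matrix (Fin N) (Fin N) ℂ) (specialUnitaryUnits (Fin N)) R₁ R₂ x).Reg336 c α₀ U →
        HasMaj (cNorm 1 (H x) (𝔬12 x).blk (fun y => (geo9Y_len_pos x y).le) 0) (cNorm 1 (H x) (𝔬12 x).blkW (fun y => (geo9Y_len_pos x y).le) 1)
          ((𝔬12 x).R U ∘ₗ (𝔬12 x).Dvstar U ∘ₗ (𝔬12 x).G1 U ∘ₗ LinearMap.id) (fun a b => Brg * Real.exp (-(δ₃ * (geo9Y x).dist a b))))
    (hrgdG : ∀ x : MemberY d ℓ hd hL b₀ b₁ Mstar, letI : Fintype (geo9K x.toKIdx).Site := (inferInstance : Fintype (geo9Y x).Site); M₀ ≤ (geo9Y x).M → ∀ α₀ : ℝ, 0 < α₀ → (geo9Y x).M * α₀ ≤ a₀ → ∀ U : (bg9YR (Matrix (Fin N) (Fin N) ℂ) (specialUnitaryUnits (Fin N)) R₁ R₂ x).Cfg, (bg9YR (Matrix (Fin N) (Fin N) ℂ) (specialUnitaryUnits (Fin N)) R₁ R₂ x).Reg335 c α₀ U →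
      (bg9YR (Matrix (Fin N) (Fin N) ℂ) (specialUnitaryUnits (Fin N)) R₁ R₂ x).Reg336 c α₀ U →
        HasMaj (cNorm 1 (H x) (𝔬12 x).blk (fun y => (geo9Y_len_pos x y).le) 0) (cNormR 1 (H x) (𝔬12 x).blk (fun y => (geo9Y_len_pos x y).le) 0)
          ((𝔬12 x).Dv U ∘ₗ ((𝔬12 x).R U ∘ₗ (𝔬12 x).Dvstar U ∘ₗ (𝔬12 x).G1 U ∘ₗ LinearMap.id)) (fun a b => C₁ * Real.exp (-(δ₃ * (geo9Y x).dist a b))))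
    (hB₃ : (((ℓ + 1 : ℕ) : ℝ)) * (Brg * Real.exp (δ₃ * (rNear d ℓ + 1)) +
        (((d : ℝ) + 1) * (coordBound39 (trBasis N) * basisBound39 (trBasis N))) * C₁ * Real.exp (δ₃ * (rNear d ℓ + (2 * ((d : ℝ) + 1) * (((ℓ + 1 : ℕ) : ℝ)) ^ 2 + 2)))) ≤ B₃) :
    ∀ x : MemberY d ℓ hd hL b₀ b₁ Mstar, letI : Fintype (geo9K x.toKIdx).Site := (inferInstance : Fintype (geo9Y x).Site); M₀ ≤ (geo9Y x).M → ∀ α₀ : ℝ, 0 < α₀ → (geo9Y x).M * α₀ ≤ a₀ → ∀ U : (bg9YR (Matrix (Fin N) (Fin N) ℂ) (specialUnitaryUnits (Fin N)) R₁ R₂ x).Cfg, (bg9YR (Matrix (Fin N) (Fin N) ℂ) (specialUnitaryUnits (Fin N)) R₁ R₂ x).Reg335 c α₀ U →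
      (bg9YR (Matrix (Fin N) (Fin N) ℂ) (specialUnitaryUnits (Fin N)) R₁ R₂ x).Reg336 c α₀ U →
        HasMaj (cNorm 1 (H x) (𝔬12 x).blk (fun y => (geo9Y_len_pos x y).le) 0) (bH13 x U)
          ((𝔬12 x).R U ∘ₗ (𝔬12 x).Dvstar U ∘ₗ (𝔬12 x).G1 U ∘ₗ LinearMap.id) (fun a b => B₃ * Real.exp (-(δ₃ * (geo9Y x).dist a b))) := fun x hM α₀ hα ha U hU hU' => by
  letI : Fintype (geo9K x.toKIdx).Site := (inferInstance : Fintype (geo9Y x).Site)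
  have hsup := hrgd2 x hM α₀ hα ha U hU hU'
  rw [hblkW12 x, cNorm_one_eq_cNormR] at hsup
  have hgrad := hrgdG x hM α₀ hα ha U hU hU'
  rw [hDvco12 x U] at hgrad
  conv at hgrad => arg 2; rw [hblk12 x]
  rw [hbH13 x U]
  exact (hasMaj_into_bHZPG_of_grad x.toKIdx (trBasis N) (bg9YR (Matrix (Fin N) (Fin N) ℂ) (specialUnitaryUnits (Fin N)) R₁ R₂ x) (fun U => U) (fun y => (geo9Y_len_pos x y).le) w13 hw13₀ hw13₁ (hβ1 x) (hlev x) hδ₃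
    (abs_cf_eq_nKT x.toKIdx x.hcfk) (links_le_one hGR x hU) hBrg hC₁ hsup hgrad).mono fun a b => mul_le_mul_of_nonneg_right hB₃ (Real.exp_nonneg _)

end Summit.QuantumFields.YangMills.BalabanUVNodes.N06RgdHLegAtPinsPhysPU

end
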